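import Mathlib
import Summits.NavierStokesRegularity.NavierStokesRegularity.Theses.TaoLadderRungTwo
import HarnessLib

/-!
# `TaoLadderRungTwo.Assembly` — the route's assembly (item stmt-NavierStokesRegularity-20501;
  pure logic)

**Statement.** `ComparableGapCertificates → GappedFrontRobust → RestartControl → RestartGlue →
LocalDynamicsSufficesAt → Target`.

PROOF. The route file `Theses/TaoLadderRungTwo.lean` carries the planner-authored, kernel-checked
deciding theorem `Theses.TaoLadderRungTwo.closes`, whose hypotheses are exactly the route's two
cruxes and three supports and whose conclusion is the registered rung leaf `Target` (TL-M2, D-0061);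
the assembly item is that implication written as ONE proposition, so it is closed by applying
`closes` to the hypotheses.

HONEST FRAMING: glue between the route's own statements about a MODEL lattice (Tao 2016's cascade
class with comparable coefficients); nothing here is a statement about the Navier–Stokes equations, and
the rung leaf is not the summit Statement.
-/

noncomputable section

set_option linter.dupNamespace false

namespace Summit.NavierStokesRegularity.NavierStokesRegularity.Theorems

open Summit.NavierStokesRegularity.NavierStokesRegularity.Theses.TaoLadderRungTwo in
/-- **Item stmt-NavierStokesRegularity-20501** (`TaoLadderRungTwo.Assembly`): the route's two
cruxes and three supports imply its registered rung leaf `Target`, by the route file's deciding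
theorem `closes`. [this file] -/
theorem taoLadderRungTwo_assembly_proof :
    Summit.NavierStokesRegularity.NavierStokesRegularity.Theses.TaoLadderRungTwo.Assembly := by
  unfold Summit.NavierStokesRegularity.NavierStokesRegularity.Theses.TaoLadderRungTwo.Assembly
  intro h₁ h₂ h₃ h₄ h₅
  -- buildfix (bf3-g27, 2026-08-27): the route's `closes` was re-keyed (21:41Z) to the v2 cruxes
  -- `ComparableGapCertificatesV2` / `GappedFrontRobustV2`; this CLOSED assembly item keeps its accepted
  -- v1 statement, so the pre-v2 chain of `closes` is inlined: v1 gap data feeds v1 `GappedFrontRobust`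
  -- directly (no `GapData₂.toGapData`, no thin-tail clause); the restart/glue/local-dynamics steps are
  -- verbatim the route file's. Statement byte-identical.
  obtain ⟨R, hR, εs, hεs₀, hεs₁, hall⟩ := h₁
  refine ⟨R, hR, εs, hεs₀, hεs₁, fun ε₀ hε₀ hε₀s => ?_⟩
  obtain ⟨i₀, α, X₀, Z, w, r, ρ, θ₀, θ, c₀, c, env₀, hα, hX₀, hgap⟩ := hall ε₀ hε₀ hε₀s
  obtain ⟨η, env, hη, -, hstep⟩ := h₂ R ε₀ i₀ α X₀ Z w r ρ θ₀ θ c₀ c env₀ hα hε₀ hgap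
  obtain ⟨-, -, -, hθ₀, hθ₀θ, hθ, hc₀, hc₀c, -⟩ :=
    Literature.Analysis.FluidPDE.TaoCascade.GapData.signs hgap
  have hball := Literature.Analysis.FluidPDE.TaoCascade.GapData.datum_mem_ball hgap
    (Literature.Analysis.FluidPDE.TaoCascade.datumEnergy i₀ X₀)
  have hc : 0 < c := lt_trans hc₀ hc₀c
  have hdyn : Literature.Analysis.FluidPDE.TaoCascade.DynamicsLocalAt ε₀ R := by
    refine ⟨θ, c, i₀, α, X₀, Literature.Analysis.FluidPDE.TaoCascade.ballDesc Z w r,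
      Literature.Analysis.FluidPDE.TaoCascade.epochEnvelope env, by linarith, by linarith, hc,
      hα, hX₀, hball, ?_⟩
    intro K₁ K₂ hK₁ hK₂
    obtain ⟨N₀, hN₀⟩ := h₃ ε₀ θ c η i₀ α X₀
      (Literature.Analysis.FluidPDE.TaoCascade.ballDesc Z w r) env K₁ K₂ hε₀ hθ hc.le hη hX₀ hK₁ hK₂
    refine ⟨N₀, fun n₀ hn₀ T hT X E hsol N hN t e hcp hhor => ?_⟩
    have heN : 0 < e N := hcp.e_pos N hN le_rfl
    have hpow : 0 < (1 + ε₀) ^ ((5 : ℝ) * N / 2) := Real.rpow_pos_of_pos (by linarith) _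
    have hγ : 0 < e N * (1 + ε₀) ^ ((5 : ℝ) * N / 2) := mul_pos heN hpow
    have hneg : (1 + ε₀) ^ (-(5 : ℝ) * N / 2) = ((1 + ε₀) ^ ((5 : ℝ) * N / 2))⁻¹ := by
      rw [← Real.rpow_neg (by linarith : (0 : ℝ) ≤ 1 + ε₀)]
      congr 1
      ring
    have hcγ : c * (1 + ε₀) ^ (-(5 : ℝ) * N / 2) * (e N)⁻¹ =
        c / (e N * (1 + ε₀) ^ ((5 : ℝ) * N / 2)) := by
      rw [hneg]
      field_simp
    rw [hcγ] at hhor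
    have hdiv : 0 < c / (e N * (1 + ε₀) ^ ((5 : ℝ) * N / 2)) := div_pos hc hγ
    have htN : t N < T := by linarith
    have hτ : c ≤ (T - t N) * (e N * (1 + ε₀) ^ ((5 : ℝ) * N / 2)) := by
      have h2 : c / (e N * (1 + ε₀) ^ ((5 : ℝ) * N / 2)) ≤ T - t N := by linarith
      have h3 := mul_le_mul_of_nonneg_right h2 hγ.le
      rwa [div_mul_cancel₀ c hγ.ne'] at h3
    obtain ⟨hflow, hslack⟩ := hN₀ n₀ hn₀ T hT X E hsol N hN t e hcp htN
    obtain ⟨τ₁, a, hst⟩ :=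
      hstep (N - n₀).toNat _ _ _ (hcp.state N hN le_rfl) hslack _ hτ _ _ hflow
    exact ⟨_, _, h₄ ε₀ θ c 4 i₀ n₀ X₀ _ _ N X E t e τ₁ a hε₀ hN hcp hst⟩
  exact h₅ ε₀ R hε₀ hR hdyn

end Summit.NavierStokesRegularity.NavierStokesRegularity.Theorems

end
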